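import Mathlib

/-!
# `Balaban1983to89.B5ChangeOfGauge123` — T. Bałaban, *Propagators and renormalization transformations for lattice
# gauge theories. I*, Commun. Math. Phys. **95** (1984) 17–40 [Balaban1984PropagatorsI], Sect. C *"Change of gauge"*,
# (1.22)–(1.23) p. 21: the Faddeev–Popov passage from the axial gauge of (1.17) to the gauge-fixing term of (1.23) —
# PROVED as one identity of integrals over abstract carriers (the unit (1.22), the printed swaps/translations, and the
# constant Jacobian `z^{(k)} → z′^{(k)}` of slice ⊕ gauge-orbit coordinates)

statement-level skeleton of published theorems with citation tags; proofs where landed; nothing here is a claim about the Yang–Mills mass gap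

PDF held: `paper:balaban1984-cmp95-propagators-rt-i` (journal page = PDF page + 16); the displays were read AS IMAGES on the
×2 renders `run/shared/lean/pub/pub-balaban/b2b-balaban-ref1/pages/1984-cmp95-propagators-rt-I/…-p004-x2.png` (p. 20:
(1.16)–(1.20)) and `…-p005-x2.png` (p. 21: (1.21)–(1.24)) by this seat (2026-08-21).

CITATION HEADER (lean-in-tree rule).  WHAT IS REPRODUCED: lit-balaban SKELETON row **B5.Eq1.23** (owner r02; *"[CLAIM]
Faddeev–Popov: insert 1 = …, change variables ⇒ (1.17) = … (1.23)"*, status `absent (the displayed identity; cell flag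
G-B5-01: unstated FP lemma)`; PHASE-2 SPARE list of ruling G.5-12, taken by the finished seat p22).  WHAT THE TREE ALREADY
HAS AND IS NOT RESTATED: the combinatorial core of the passage — completeness and uniqueness of the hierarchical block-axial
gauge on `N(Q′_k)` — is `…Balaban1983to89.B5.HierGauge.complete` / `.unique` / `.reconstruct` (cell GAPS G-B5-01R); the
Gaussian evaluation of the orbit integral, (1.24)–(1.28), (1.39)–(1.41), (1.46), is `…B5GaussSectC` (`integral_124`,
`calG_eq_127`, `integral_146`, …); (1.47) ⇒ (1.64) is `…B5Hk164Transl`, whose HONEST SCOPE (i) names *"the passage from the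
axial to the Landau gauge (1.23)/(1.46)"* as not typed; `…B6Eq295` (part II, (2.96): *"Such an identity was used already in
the change of gauge formula (1.23)"*) records *"(2.96)'s unit Jacobian is not typed here"*; `…B9SectDFP` records *"the global
Fubini / order-of-integration bookkeeping … as ONE identity of normalised integrals"* as not certified.  This file supplies
exactly that bookkeeping, abstractly, importing Mathlib only.

PRINT (p. 21 [PDF 5], verbatim).  *"We want to remove the second term in the action by a gauge fixing term, so we introduce
under the integral (1.17) the identity
  1 = ∫dλ′ δ(Q′_kλ′) exp(−(1/2α)⟨∂*A^{λ′}, ∂*A^{λ′}⟩) / ∫dλ δ(Q′_kλ) exp(−(1/2α)⟨∂*A^λ, ∂*A^λ⟩).   (1.22)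
The restrictions on the gauge transformations given by the δ-functions above are chosen in such a way that all the
expressions in the integral (1.17) with the exception of gauge fixing terms δ_Ax are invariant. Next we will calculate the
expression in the numerator and denominator above and we will see that it is different from 0, but now let us transform
(1.17). We change the order of integrations ∫dA∫dλ′…, and we make the gauge transformation −λ′ in the integral ∫dA….
We change the order of integrations again and we make a translation λ → λ + λ′ in the integral ∫dλ…. We get
  (1.17) = z^{(k)} ∫dA δ(B − Q_kA)(∫dλ′ δ(Q′_kλ′)·δ_Ax(Q_{k−1}A + ∂^{L^{−1}}Q′_{k−1}λ′)·…·δ_Ax(A + ∂^ηλ′))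
           ·exp(−(1/2α)⟨∂*A, ∂*A⟩)(∫dλ δ(Q′_kλ) exp(−(1/2α)⟨∂*A^λ, ∂*A^λ⟩))⁻¹ e^{−S^η(A)}
         = z′^{(k)} ∫dA δ(B − Q_kA) exp(−(1/2α)⟨∂*A, ∂*A⟩)·(∫dλ δ(Q′_kλ) exp(−(1/2α)⟨∂*A^λ, ∂*A^λ⟩))⁻¹ e^{−S^η(A)}.   (1.23)"*
Context, p. 20 [PDF 4]: *"((ST)^k e^{−S})(B) = z^{(k)} ∫dA δ(B − Q_kA)δ_Ax(Q_{k−1}A)·…·δ_Ax(A)e^{−S^η(A)}, (1.17)"*;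
*"A^λ = A − ∂^ηλ, (Q_kA^λ)_b = (Q_kA)_b − (…), (1.20) or … Q_kA^λ = Q_kA − ∂Q′_kλ. The δ-function δ(B − Q_kA) is invariant with
respect to gauge transformations λ satisfying Q′_kλ = 0 and we can look at the integral (1.17) as obtained by removing this
gauge freedom by the help of the δ-functions δ_Ax."*

TYPING (the convention of `…B6Eq295` §4, `…B5Hk164Transl` §3, `…B5GaussSectC`: a δ-function of linear constraints = the
flat measure of the constraint set, carried by a parameter space; every hypothesis displayed, nothing printed is smuggled).
* Fields `A` live in an abstract real vector space `X`.  The residual gauge group `N(Q′_k) = {λ : Q′_kλ = 0}` is an abstract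
  additive group `Λ` with a measure `ν`; `∫dλ δ(Q′_kλ) F(λ)` is `∫ l, F l ∂ν` (for the identities of §1 `ν` is ANY
  left-invariant measure, `[ν.IsAddLeftInvariant]`; Lebesgue measure of `N(Q′_k)` is one).  The gauge action (1.20) is
  `A^λ = A − D λ` with `D : Λ →ₗ[ℝ] X` (= `∂^η` on `N(Q′_k)`).  The gauge-fixing weight `exp(−(1/2α)⟨∂*A, ∂*A⟩)` is an
  arbitrary function `g : X → ℝ` (so `g(A^λ)` is the weight of (1.22)), the invariant density `e^{−S^η(A)}` (with any other
  invariant factor) an arbitrary `ρ : X → ℝ` with `ρ(A − Dλ) = ρ(A)` on the configurations met.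
* The measure `z^{(k)}dA δ(B − Q_kA)δ_Ax(Q_{k−1}A)·…·δ_Ax(A)` of (1.17) — the flat measure of the AXIAL SLICE over `B` (all
  constraints are linear) — is carried by a parameter space `M₀` with a measure `μ₀` and a parametrisation `s : M₀ → X`:
  `(1.17) = z * ∫ m, ρ (s m) ∂μ₀`.  The shifted constraints `δ(B − Q_kA)·Π_jδ_Ax(Q_jA + ∂Q′_jλ′)` of the first line of (1.23)
  say `A + Dλ′ ∈ slice`, i.e. `A = s m − D l′`: the first line is the iterated integral `∫ m, ∫ l′, … (s m − D l′)`.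
* The measure `dA δ(B − Q_kA)` of the second line — the flat measure of the whole FIBRE `{Q_kA = B}` — is carried by a
  parameter space `N` with measure `μ` and an affine parametrisation `n ↦ a₀ + ι n` (as in `…B6Eq295` §4).  The one
  structural input of the second equality is that slice ⊕ gauge-orbit coordinates ARE coordinates of the fibre: a linear
  isomorphism `e : M₀ × Λ ≃ N` with `a₀ + ι(e(m, l)) = s m − D l` (hypothesis `he`).  In the model this is exactly the
  tree's `B5.HierGauge.complete` (every `A` has a `λ ∈ N(Q′_k)` with all `Q_jA^λ` axial) and `B5.HierGauge.unique` (only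
  one), together with `Q_k∂λ = ∂Q′_kλ = 0` ((1.20)); it is taken here as the displayed hypothesis, not re-derived.

WHAT IS PROVED (no definitions; every declaration a theorem; Mathlib only).
§1 (abstract, any left-invariant `ν`, no integrability anywhere — Lean's `∫` of a non-integrable function is `0` and constants
   commute with `∫` unconditionally): `orbit_integral_gauge` (the orbit integral `∫dλ δ(Q′_kλ) g(A^λ)` is gauge invariant:
   the printed *"translation λ → λ + λ′"*); `eq122` ((1.22) verbatim, under `∫dλ δ(Q′_kλ)g(A^λ) ≠ 0` — print: *"we will see
   that it is different from 0"*); `eq122_under_integral` (the unit with its invariant denominator under the `λ′`-integral);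
   **`fp_pointwise`** — the net effect, at a fixed configuration `A` of the slice, of *"insert (1.22), change the order of
   integrations, gauge transformation −λ′, change the order again, translation λ → λ + λ′"*:
   `ρ(A) = ∫dλ′ δ(Q′_kλ′) g(A^{λ′})·(∫dλ δ(Q′_kλ) g((A^{λ′})^λ))⁻¹·ρ(A^{λ′})`; **`eq123_first_line`** — (1.17) = the first
   line of (1.23) (as the iterated integral), for every `z`, `μ₀`, `s`.
§2 (finite-dimensional real normed spaces `M₀`, `Λ`, `N` with additive Haar measures `μ₀`, `ν`, `μ` — e.g. Lebesgue
   measures in any linear coordinates): **`map_slice_orbit_eq_smul`** — `(μ₀ ⊗ ν)∘e⁻¹ = c • μ` with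
   `c = addHaarScalarFactor ((μ₀ ⊗ ν)∘e⁻¹) μ`, `0 < c` (`jacobian_pos`): the constant Jacobian, i.e. the typed content of
   the normalisation *"∫dλ′ δ(Q′_kλ′)Π_jδ_Ax(Q_jA + ∂Q′_jλ′) = const"* (part II (2.96): *"= 1"* in matched normalisations)
   — from Mathlib's uniqueness of Haar measure; `integral_comp_slice_orbit`, `integral_slice_orbit` (the corresponding
   change of variables in integrals, for every integrand, vector-valued).
§3 **`eq123_of_integrable`**, **`eq123`** — (1.23) AS PRINTED, both equalities composed:
   `z^{(k)} ∫[slice] ρ = (z^{(k)}·c) ∫[fibre] g(A)(∫dλ δ(Q′_kλ)g(A^λ))⁻¹ρ(A) dA`, i.e. `z′^{(k)} = z^{(k)}·c`; the first under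
   absolute convergence of the first line, the second with NO integrability hypothesis for non-negative `g`, `ρ` (the
   printed exponentials), only joint measurability — by Tonelli both sides then vanish together when (1.17) diverges;
   `eq123_zprime` — the same packaged over all base points `a` (all `B`) with ONE constant `c > 0` independent of `B`, `g`, `ρ`,
   `z`.  Auxiliary: `integrable_orbit_of_ne_zero`, `orbit_integral_nonneg`.

READINGS (none is an objection to print).  (a) (1.22)'s quotient needs its denominator `≠ 0`; print defers this to (1.24) ff.
(`…B5GaussSectC.integral_124`, `ZN_eq`: it is a Gaussian integral `> 0`); here it is the hypothesis `hZ` on the slice.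
(b) The two *"change the order of integrations"* cancel at fixed `A`; what remains of them is Fubini between the slice
variable and `λ′` (§3), which needs absolute convergence or non-negativity — supplied as displayed hypotheses.  (c) `z′^{(k)}`
is not spelled out in print (*"a numerical factor"*); it is `z^{(k)}` times the Jacobian `c` of §2, which depends on the chosen
flat normalisations of the three δ-measures and on nothing else (not on `B`, `α`, `A`).  (d) Linear (`𝔤`-valued, small-field)
setting of Sect. 1 of the paper: `A^λ = A − ∂λ`; the group-valued Faddeev–Popov argument of [Balaban1987RG1] (0.15)–(0.16) is
the tree's `…B12FaddeevPopov016`, a different statement (product gauge fixing, unit normaliser).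
HONEST SCOPE.  Not typed here: the identification of `M₀`, `N`, `Λ`, `s`, `ι`, `D`, `e` with the lattice objects of (1.6)–(1.20)
(the V1-carrier programme of rows B5.Eq1.11–1.18 / B5.Eq1.12: `…B5Eq118OneStroke`, `…B5Eq120IterProof`, and successors) — this
file is the measure-theoretic engine they instantiate; (1.24) ff. (tree, cited above).  Value = kernel certificate of the
displayed bookkeeping (1.22) ⇒ (1.23), NOT summit progress.
Unit `lit-balaban-p22` (PHASE-2 proof seat, SPARE row), HOME `run/shared/lean/pub/lit-balaban/`, 2026-08-21.
-/

noncomputable section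

open MeasureTheory

namespace Literature.MathematicalPhysics.QuantumFieldTheory.Balaban1983to89.B5ChangeOfGauge123

/-! ## §1  The residual gauge orbit: the unit (1.22) and the pointwise Faddeev–Popov identity -/

section Orbit

variable {X : Type*} [AddCommGroup X] [Module ℝ X]
variable {Λ : Type*} [AddCommGroup Λ] [Module ℝ Λ] [MeasurableSpace Λ]

/-- Gauge invariance of the orbit integral: for `λ₀ ∈ N(Q′_k)`,
`∫dλ δ(Q′_kλ) g((A^{λ₀})^λ) = ∫dλ δ(Q′_kλ) g(A^λ)` (`A^λ = A − ∂^ηλ`, (1.20)) — the printed *"translation λ → λ + λ′ in the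
integral ∫dλ…"*, valid for every left-invariant measure on `N(Q′_k)` and every weight `g`.
[cite: Balaban1984PropagatorsI, (1.22)–(1.23) p.21] -/
theorem orbit_integral_gauge [MeasurableAdd Λ] (ν : Measure Λ) [ν.IsAddLeftInvariant] (D : Λ →ₗ[ℝ] X)
    (g : X → ℝ) (A : X) (l₀ : Λ) :
    ∫ l, g (A - D l₀ - D l) ∂ν = ∫ l, g (A - D l) ∂ν := by
  have h : (fun l => g (A - D l₀ - D l)) = fun l => (fun l' => g (A - D l')) (l₀ + l) := by
    funext l
    simp only [map_add, sub_sub]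
  rw [h]
  exact integral_add_left_eq_self (fun l' => g (A - D l')) l₀

/-- The orbit integral `∫dλ δ(Q′_kλ) g(A^λ)` of a non-negative weight (the denominator of (1.22)) is non-negative.
[cite: Balaban1984PropagatorsI, (1.22) p.21] -/
theorem orbit_integral_nonneg (ν : Measure Λ) (D : Λ →ₗ[ℝ] X) (g : X → ℝ) (hg : ∀ A, 0 ≤ g A) (A : X) :
    0 ≤ ∫ l, g (A - D l) ∂ν :=
  integral_nonneg fun l => hg (A - D l)

/-- A non-vanishing orbit integral `∫dλ δ(Q′_kλ) g(A^λ) ≠ 0` (the denominator of (1.22): *"we will see that it is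
different from 0"*) is an absolutely convergent one (Lean's `∫` of a non-integrable function is `0`), so the printed proviso
carries the convergence used in §3. [cite: Balaban1984PropagatorsI, (1.22) p.21] -/
theorem integrable_orbit_of_ne_zero (ν : Measure Λ) (D : Λ →ₗ[ℝ] X) (g : X → ℝ) (A : X)
    (hZ : ∫ l, g (A - D l) ∂ν ≠ 0) : Integrable (fun l => g (A - D l)) ν := by
  by_contra h
  exact hZ (integral_undef h)

/-- **(1.22)**, as displayed: `1 = ∫dλ′ δ(Q′_kλ′) exp(−(1/2α)⟨∂*A^{λ′},∂*A^{λ′}⟩) / ∫dλ δ(Q′_kλ) exp(−(1/2α)⟨∂*A^λ,∂*A^λ⟩)`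
— for any weight `g` in place of the exponential, provided the orbit integral is `≠ 0` (print: *"we will see that it is
different from 0"*, (1.24) ff.; tree `…B5GaussSectC.integral_124`). [cite: Balaban1984PropagatorsI, (1.22) p.21] -/
theorem eq122 (ν : Measure Λ) (D : Λ →ₗ[ℝ] X) (g : X → ℝ) (A : X) (hZ : ∫ l, g (A - D l) ∂ν ≠ 0) :
    (1 : ℝ) = (∫ l', g (A - D l') ∂ν) / ∫ l, g (A - D l) ∂ν :=
  (div_self hZ).symm

/-- (1.22) with its gauge-invariant denominator moved under the `λ′`-integral — the form in which the unit sits in the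
first line of (1.23): `∫dλ′ δ(Q′_kλ′) g(A^{λ′})·(∫dλ δ(Q′_kλ) g((A^{λ′})^λ))⁻¹ = 1`.
[cite: Balaban1984PropagatorsI, (1.22)–(1.23) p.21] -/
theorem eq122_under_integral [MeasurableAdd Λ] (ν : Measure Λ) [ν.IsAddLeftInvariant] (D : Λ →ₗ[ℝ] X)
    (g : X → ℝ) (A : X) (hZ : ∫ l, g (A - D l) ∂ν ≠ 0) :
    ∫ l', g (A - D l') * (∫ l, g (A - D l' - D l) ∂ν)⁻¹ ∂ν = 1 := by
  simp_rw [orbit_integral_gauge ν D g A]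
  rw [integral_mul_const, mul_inv_cancel₀ hZ]

/-- **The Faddeev–Popov step, pointwise on the axial slice.**  At a configuration `A` of (1.17) where the invariant factor
`ρ` (= `e^{−S^η}` and the other invariant expressions, p. 21) satisfies `ρ(A^λ) = ρ(A)` for `λ ∈ N(Q′_k)` and the orbit integral
is `≠ 0`, the printed operations *"introduce under the integral (1.17) the identity (1.22) … change the order of integrations
∫dA∫dλ′ …, gauge transformation −λ′ in the integral ∫dA …, change the order of integrations again, translation λ → λ + λ′ in
the integral ∫dλ"* amount to
`ρ(A) = ∫dλ′ δ(Q′_kλ′) g(A^{λ′})·(∫dλ δ(Q′_kλ) g((A^{λ′})^λ))⁻¹·ρ(A^{λ′})`.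
[cite: Balaban1984PropagatorsI, (1.22)–(1.23) p.21] -/
theorem fp_pointwise [MeasurableAdd Λ] (ν : Measure Λ) [ν.IsAddLeftInvariant] (D : Λ →ₗ[ℝ] X)
    (g ρ : X → ℝ) (A : X) (hρ : ∀ l, ρ (A - D l) = ρ A) (hZ : ∫ l, g (A - D l) ∂ν ≠ 0) :
    ∫ l', g (A - D l') * (∫ l, g (A - D l' - D l) ∂ν)⁻¹ * ρ (A - D l') ∂ν = ρ A := by
  simp_rw [orbit_integral_gauge ν D g A, hρ]
  rw [integral_mul_const, integral_mul_const, mul_inv_cancel₀ hZ, one_mul]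

/-- **(1.17) = the first line of (1.23).**  With the axial slice `{Q_kA = B, δ_Ax(Q_jA) ∀ j < k}` of (1.17) carried by
`(M₀, μ₀, s)` (`(1.17) = z^{(k)} ∫ m, ρ(s m) dμ₀`) and the shifted constraints
`δ(B − Q_kA)·δ_Ax(Q_{k−1}A + ∂^{L^{−1}}Q′_{k−1}λ′)·…·δ_Ax(A + ∂^ηλ′)` of (1.23) read as `A + ∂λ′ ∈ slice`, i.e. `A = s m − Dλ′`:
`z^{(k)} ∫ m, ρ(s m) dμ₀ = z^{(k)} ∫ m, ∫dλ′ δ(Q′_kλ′) [g·(∫dλ δ(Q′_kλ) g(·^λ))⁻¹·ρ](s m − Dλ′) dμ₀`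
— for every measure `μ₀`, every `z^{(k)}`, every left-invariant `ν`; hypotheses: `ρ` invariant along the orbits of the slice,
the orbit integrals of `g` non-zero there. [cite: Balaban1984PropagatorsI, (1.17) p.20, (1.23) p.21] -/
theorem eq123_first_line [MeasurableAdd Λ] (ν : Measure Λ) [ν.IsAddLeftInvariant] (D : Λ →ₗ[ℝ] X)
    (g ρ : X → ℝ) {M₀ : Type*} [MeasurableSpace M₀] (μ₀ : Measure M₀) (s : M₀ → X)
    (hρ : ∀ m l, ρ (s m - D l) = ρ (s m)) (hZ : ∀ m, ∫ l, g (s m - D l) ∂ν ≠ 0) (z : ℝ) :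
    z * ∫ m, ρ (s m) ∂μ₀ =
      z * ∫ m, (∫ l', g (s m - D l') * (∫ l, g (s m - D l' - D l) ∂ν)⁻¹ * ρ (s m - D l') ∂ν) ∂μ₀ := by
  congr 1
  refine integral_congr_ae (ae_of_all _ fun m => ?_)
  exact (fp_pointwise ν D g ρ (s m) (hρ m) (hZ m)).symm

end Orbit

/-! ## §2  Slice ⊕ gauge-orbit coordinates on the fibre `{Q_kA = B}`: the constant Jacobian `z^{(k)} → z′^{(k)}` -/

section Jacobian

variable {M₀ Λ N E : Type*}
  [NormedAddCommGroup M₀] [NormedSpace ℝ M₀] [FiniteDimensional ℝ M₀] [MeasurableSpace M₀] [BorelSpace M₀]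
  [NormedAddCommGroup Λ] [NormedSpace ℝ Λ] [FiniteDimensional ℝ Λ] [MeasurableSpace Λ] [BorelSpace Λ]
  [NormedAddCommGroup N] [NormedSpace ℝ N] [FiniteDimensional ℝ N] [MeasurableSpace N] [BorelSpace N]
  [NormedAddCommGroup E] [NormedSpace ℝ E]

/-- **The unit Jacobian, as a statement about measures.**  If the slice parameters `M₀` and the residual gauge group
`Λ = N(Q′_k)` are linear coordinates of the fibre directions `N` (`e : M₀ × Λ ≃ N` — in the model: `B5.HierGauge.complete` and
`.unique`, every configuration is `(axial) − ∂λ` for exactly one `λ ∈ N(Q′_k)`), then for additive Haar (e.g. Lebesgue) measures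
`μ₀`, `ν`, `μ` the image of `μ₀ ⊗ ν` under `e` is `c • μ` with the constant `c = addHaarScalarFactor((μ₀ ⊗ ν)∘e⁻¹, μ)`: the typed
content of *"∫dλ′ δ(Q′_kλ′)·δ_Ax(Q_{k−1}A + ∂^{L^{−1}}Q′_{k−1}λ′)·…·δ_Ax(A + ∂^ηλ′) = const"*, absorbed in `z′^{(k)}`.
[cite: Balaban1984PropagatorsI, (1.23) p.21] -/
theorem map_slice_orbit_eq_smul (μ₀ : Measure M₀) (ν : Measure Λ) (μ : Measure N) [μ₀.IsAddHaarMeasure]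
    [ν.IsAddHaarMeasure] [μ.IsAddHaarMeasure] (e : (M₀ × Λ) ≃L[ℝ] N) :
    (μ₀.prod ν).map e = Measure.addHaarScalarFactor ((μ₀.prod ν).map e) μ • μ := by
  haveI : ((μ₀.prod ν).map e).IsAddHaarMeasure := e.isAddHaarMeasure_map _
  exact Measure.isAddLeftInvariant_eq_smul _ _

omit [FiniteDimensional ℝ N] in
/-- The Jacobian constant is positive (`z′^{(k)} ≠ 0` whenever `z^{(k)} ≠ 0`). [cite: Balaban1984PropagatorsI, (1.23) p.21] -/
theorem jacobian_pos (μ₀ : Measure M₀) (ν : Measure Λ) (μ : Measure N) [μ₀.IsAddHaarMeasure]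
    [ν.IsAddHaarMeasure] [μ.IsAddHaarMeasure] (e : (M₀ × Λ) ≃L[ℝ] N) :
    0 < Measure.addHaarScalarFactor ((μ₀.prod ν).map e) μ := by
  haveI : ((μ₀.prod ν).map e).IsAddHaarMeasure := e.isAddHaarMeasure_map _
  exact Measure.addHaarScalarFactor_pos_of_isAddHaarMeasure _ _

/-- Change of variables to slice ⊕ orbit coordinates, for every (vector-valued) integrand and with no integrability
hypothesis: `∫_{M₀×Λ} G(e p) d(μ₀ ⊗ ν) = c · ∫_N G dμ`. [cite: Balaban1984PropagatorsI, (1.23) p.21] -/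
theorem integral_comp_slice_orbit (μ₀ : Measure M₀) (ν : Measure Λ) (μ : Measure N) [μ₀.IsAddHaarMeasure]
    [ν.IsAddHaarMeasure] [μ.IsAddHaarMeasure] (e : (M₀ × Λ) ≃L[ℝ] N) (G : N → E) :
    ∫ p, G (e p) ∂(μ₀.prod ν) = (Measure.addHaarScalarFactor ((μ₀.prod ν).map e) μ : ℝ) • ∫ n, G n ∂μ := by
  have h1 : ∫ p, G (e p) ∂(μ₀.prod ν) = ∫ n, G n ∂((μ₀.prod ν).map e) := by
    rw [← show ((e.toHomeomorph.toMeasurableEquiv : (M₀ × Λ) ≃ᵐ N) : (M₀ × Λ) → N) = e from rfl]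
    exact (integral_map_equiv e.toHomeomorph.toMeasurableEquiv G).symm
  rw [h1]
  conv_lhs => rw [map_slice_orbit_eq_smul μ₀ ν μ e]
  rw [integral_smul_nnreal_measure]
  rfl

/-- The same change of variables written on the configurations: with the fibre `{Q_kA = B}` parametrised affinely by
`n ↦ a₀ + ι n` and slice ⊕ orbit coordinates matching it (`a₀ + ι(e(m, l)) = s m − D l`), for every integrand `Φ` on
configurations `∫∫ Φ(s m − D l) d(μ₀ ⊗ ν) = c · ∫dA δ(B − Q_kA) Φ(A)`. [cite: Balaban1984PropagatorsI, (1.23) p.21] -/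
theorem integral_slice_orbit (μ₀ : Measure M₀) (ν : Measure Λ) (μ : Measure N) [μ₀.IsAddHaarMeasure]
    [ν.IsAddHaarMeasure] [μ.IsAddHaarMeasure] (e : (M₀ × Λ) ≃L[ℝ] N) {X : Type*} [AddCommGroup X] [Module ℝ X]
    (a₀ : X) (ι : N →ₗ[ℝ] X) (s : M₀ → X) (D : Λ →ₗ[ℝ] X) (he : ∀ m l, a₀ + ι (e (m, l)) = s m - D l)
    (Φ : X → E) :
    ∫ p, Φ (s p.1 - D p.2) ∂(μ₀.prod ν) =
      (Measure.addHaarScalarFactor ((μ₀.prod ν).map e) μ : ℝ) • ∫ n, Φ (a₀ + ι n) ∂μ := by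
  have h : (fun p : M₀ × Λ => Φ (s p.1 - D p.2)) = fun p => (fun n => Φ (a₀ + ι n)) (e p) := by
    funext p
    obtain ⟨m, l⟩ := p
    simp only [he]
  rw [h]
  exact integral_comp_slice_orbit μ₀ ν μ e (fun n => Φ (a₀ + ι n))

end Jacobian

/-! ## §3  (1.23) assembled: `(1.17) = z′^{(k)} ∫dA δ(B − Q_kA) g(A)(∫dλ δ(Q′_kλ) g(A^λ))⁻¹ e^{−S^η(A)}`, `z′^{(k)} = z^{(k)}·c` -/

section Assembly

variable {M₀ Λ N X : Type*}
  [NormedAddCommGroup M₀] [NormedSpace ℝ M₀] [FiniteDimensional ℝ M₀] [MeasurableSpace M₀] [BorelSpace M₀]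
  [NormedAddCommGroup Λ] [NormedSpace ℝ Λ] [FiniteDimensional ℝ Λ] [MeasurableSpace Λ] [BorelSpace Λ]
  [NormedAddCommGroup N] [NormedSpace ℝ N] [FiniteDimensional ℝ N] [MeasurableSpace N] [BorelSpace N]
  [AddCommGroup X] [Module ℝ X]

/-- **(1.23), both equalities, under absolute convergence of its first line.**  Data as in the TYPING paragraph; `c` the
Jacobian of §2.  Then `(1.17) = z^{(k)}∫ m, ρ(s m) dμ₀ = (z^{(k)}·c) · ∫dA δ(B − Q_kA) g(A)(∫dλ δ(Q′_kλ)g(A^λ))⁻¹ρ(A)`, i.e. the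
second line of (1.23) with `z′^{(k)} = z^{(k)}·c`. [cite: Balaban1984PropagatorsI, (1.23) p.21] -/
theorem eq123_of_integrable (μ₀ : Measure M₀) (ν : Measure Λ) (μ : Measure N) [μ₀.IsAddHaarMeasure]
    [ν.IsAddHaarMeasure] [μ.IsAddHaarMeasure] (e : (M₀ × Λ) ≃L[ℝ] N) (a₀ : X) (ι : N →ₗ[ℝ] X) (s : M₀ → X)
    (D : Λ →ₗ[ℝ] X) (he : ∀ m l, a₀ + ι (e (m, l)) = s m - D l) (g ρ : X → ℝ)
    (hρ : ∀ m l, ρ (s m - D l) = ρ (s m)) (hZ : ∀ m, ∫ l, g (s m - D l) ∂ν ≠ 0)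
    (hint : Integrable (fun p : M₀ × Λ =>
      g (s p.1 - D p.2) * (∫ l, g (s p.1 - D p.2 - D l) ∂ν)⁻¹ * ρ (s p.1 - D p.2)) (μ₀.prod ν)) (z : ℝ) :
    z * ∫ m, ρ (s m) ∂μ₀ =
      (z * Measure.addHaarScalarFactor ((μ₀.prod ν).map e) μ) *
        ∫ n, g (a₀ + ι n) * (∫ l, g (a₀ + ι n - D l) ∂ν)⁻¹ * ρ (a₀ + ι n) ∂μ := by
  have hfub := integral_prod _ hint
  have hcov := integral_slice_orbit μ₀ ν μ e a₀ ι s D he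
    (fun A => g A * (∫ l, g (A - D l) ∂ν)⁻¹ * ρ A)
  rw [eq123_first_line ν D g ρ μ₀ s hρ hZ z]
  simp only at hfub hcov
  rw [← hfub, hcov, smul_eq_mul, mul_assoc]

/-- **(1.23) AS PRINTED — the change of gauge**, for non-negative weights (the printed exponentials) with NO integrability
hypothesis: with the axial-slice measure of (1.17) carried by `(M₀, μ₀, s)`, the fibre measure `dA δ(B − Q_kA)` by
`(N, μ, n ↦ a₀ + ι n)`, the residual gauge group `N(Q′_k)` by `(Λ, ν)` acting through `A^λ = A − Dλ`, slice ⊕ orbit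
coordinates of the fibre `e` (`he`; in the model `B5.HierGauge.complete/unique`), `ρ` (= `e^{−S^η}`·invariants) gauge invariant
along the slice's orbits, the orbit integrals of the gauge-fixing weight `g` non-zero on the slice ((1.24)), and the two
integrands jointly measurable:
`z^{(k)} ∫dA δ(B − Q_kA)δ_Ax(Q_{k−1}A)…δ_Ax(A) ρ(A) = z′^{(k)} ∫dA δ(B − Q_kA) g(A)·(∫dλ δ(Q′_kλ) g(A^λ))⁻¹·ρ(A)`,
`z′^{(k)} = z^{(k)}·c`, `c = addHaarScalarFactor((μ₀ ⊗ ν)∘e⁻¹, μ) > 0` (§2).  When (1.17) diverges both sides are `0` alike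
(Tonelli). [cite: Balaban1984PropagatorsI, (1.23) p.21] -/
theorem eq123 (μ₀ : Measure M₀) (ν : Measure Λ) (μ : Measure N) [μ₀.IsAddHaarMeasure]
    [ν.IsAddHaarMeasure] [μ.IsAddHaarMeasure] (e : (M₀ × Λ) ≃L[ℝ] N) (a₀ : X) (ι : N →ₗ[ℝ] X) (s : M₀ → X)
    (D : Λ →ₗ[ℝ] X) (he : ∀ m l, a₀ + ι (e (m, l)) = s m - D l) (g ρ : X → ℝ)
    (hg0 : ∀ A, 0 ≤ g A) (hρ0 : ∀ A, 0 ≤ ρ A)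
    (hgm : AEStronglyMeasurable (fun p : M₀ × Λ => g (s p.1 - D p.2)) (μ₀.prod ν))
    (hρm : AEStronglyMeasurable (fun m => ρ (s m)) μ₀)
    (hρ : ∀ m l, ρ (s m - D l) = ρ (s m)) (hZ : ∀ m, ∫ l, g (s m - D l) ∂ν ≠ 0) (z : ℝ) :
    z * ∫ m, ρ (s m) ∂μ₀ =
      (z * Measure.addHaarScalarFactor ((μ₀.prod ν).map e) μ) *
        ∫ n, g (a₀ + ι n) * (∫ l, g (a₀ + ι n - D l) ∂ν)⁻¹ * ρ (a₀ + ι n) ∂μ := by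
  -- the joint integrand of the first line of (1.23) and its factorised form (gauge invariance of `Z` and `ρ`)
  set F : M₀ × Λ → ℝ := fun p =>
    g (s p.1 - D p.2) * (∫ l, g (s p.1 - D p.2 - D l) ∂ν)⁻¹ * ρ (s p.1 - D p.2) with hFdef
  have hFeq : F = fun p => g (s p.1 - D p.2) * ((∫ l, g (s p.1 - D l) ∂ν)⁻¹ * ρ (s p.1)) := by
    funext p
    simp only [hFdef, orbit_integral_gauge ν D g (s p.1), hρ, mul_assoc]
  -- measurability of the factorised form
  have hZm : AEStronglyMeasurable (fun m => ∫ l, g (s m - D l) ∂ν) μ₀ := hgm.integral_prod_right'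
  have hWm : AEStronglyMeasurable (fun m => (∫ l, g (s m - D l) ∂ν)⁻¹ * ρ (s m)) μ₀ :=
    (hZm.aemeasurable.inv.mul hρm.aemeasurable).aestronglyMeasurable
  have hFm : AEStronglyMeasurable F (μ₀.prod ν) := by
    rw [hFeq]
    exact hgm.mul hWm.comp_fst
  -- the inner integrals: each fibre of `F` is integrable, with integral `ρ(s m)` (pointwise Faddeev–Popov)
  have hinner : ∀ m, Integrable (fun l => F (m, l)) ν := by
    intro m
    have : (fun l => F (m, l)) = fun l => g (s m - D l) * ((∫ l, g (s m - D l) ∂ν)⁻¹ * ρ (s m)) := by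
      funext l
      simp only [hFeq]
    rw [this]
    exact (integrable_orbit_of_ne_zero ν D g (s m) (hZ m)).mul_const _
  have hF0 : ∀ p, 0 ≤ F p := by
    intro p
    simp only [hFeq]
    exact mul_nonneg (hg0 _) (mul_nonneg (inv_nonneg.mpr (orbit_integral_nonneg ν D g hg0 _)) (hρ0 _))
  have hnorm : (fun m => ∫ l, ‖F (m, l)‖ ∂ν) = fun m => ρ (s m) := by
    funext m
    have h1 : (fun l => ‖F (m, l)‖) = fun l => F (m, l) := by
      funext l
      exact Real.norm_of_nonneg (hF0 _)
    rw [h1]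
    simp only [hFdef]
    exact fp_pointwise ν D g ρ (s m) (hρ m) (hZ m)
  by_cases hI : Integrable (fun m => ρ (s m)) μ₀
  · -- absolutely convergent case: Tonelli gives joint integrability, then `eq123_of_integrable`
    have hint : Integrable F (μ₀.prod ν) := by
      rw [integrable_prod_iff hFm]
      exact ⟨ae_of_all _ hinner, by rw [hnorm]; exact hI⟩
    exact eq123_of_integrable μ₀ ν μ e a₀ ι s D he g ρ hρ hZ (by simpa only [hFdef] using hint) z
  · -- divergent case: both sides vanish
    have hL : ∫ m, ρ (s m) ∂μ₀ = 0 := integral_undef hI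
    have hnint : ¬ Integrable F (μ₀.prod ν) := by
      intro hint
      apply hI
      have h2 := ((integrable_prod_iff hFm).1 hint).2
      rwa [hnorm] at h2
    have hR0 : ∫ p, F p ∂(μ₀.prod ν) = 0 := integral_undef hnint
    have hcov := integral_slice_orbit μ₀ ν μ e a₀ ι s D he
      (fun A => g A * (∫ l, g (A - D l) ∂ν)⁻¹ * ρ A)
    have hc : (0 : ℝ) < Measure.addHaarScalarFactor ((μ₀.prod ν).map e) μ := by
      exact_mod_cast jacobian_pos μ₀ ν μ e
    have hfib : ∫ n, g (a₀ + ι n) * (∫ l, g (a₀ + ι n - D l) ∂ν)⁻¹ * ρ (a₀ + ι n) ∂μ = 0 := by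
      have h3 : (Measure.addHaarScalarFactor ((μ₀.prod ν).map e) μ : ℝ) •
          ∫ n, g (a₀ + ι n) * (∫ l, g (a₀ + ι n - D l) ∂ν)⁻¹ * ρ (a₀ + ι n) ∂μ = 0 := by
        rw [← hcov]
        simpa only [hFdef] using hR0
      rcases smul_eq_zero.mp h3 with h | h
      · exact absurd h hc.ne'
      · exact h
    rw [hL, hfib, mul_zero, mul_zero]

/-- **`z′^{(k)}`: one constant for all `B`.**  In the setting of `eq123` with the slices and fibres over the various `B`
realised as translates (`s = a + σ·`, fibre `a + ι·`, the same coordinates `e`, `σ`, `ι`, `D` for all base points `a`),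
there is ONE constant `c > 0` — depending only on the three flat normalisations and `e`, not on `B`, `g`, `ρ`, `z` — with
`z^{(k)} ∫[axial slice over B] ρ = (z^{(k)}·c) ∫dA δ(B − Q_kA) g(A)(∫dλ δ(Q′_kλ)g(A^λ))⁻¹ρ(A)` for every base point:
*"= z′^{(k)} ∫dA δ(B − Q_kA) exp(−(1/2α)⟨∂*A,∂*A⟩)(∫dλ δ(Q′_kλ)exp(−(1/2α)⟨∂*A^λ,∂*A^λ⟩))⁻¹ e^{−S^η(A)}. (1.23)"*.
[cite: Balaban1984PropagatorsI, (1.23) p.21] -/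
theorem eq123_zprime (μ₀ : Measure M₀) (ν : Measure Λ) (μ : Measure N) [μ₀.IsAddHaarMeasure]
    [ν.IsAddHaarMeasure] [μ.IsAddHaarMeasure] (e : (M₀ × Λ) ≃L[ℝ] N) (σ : M₀ →ₗ[ℝ] X) (ι : N →ₗ[ℝ] X)
    (D : Λ →ₗ[ℝ] X) (he : ∀ m l, ι (e (m, l)) = σ m - D l) :
    ∃ c : ℝ, 0 < c ∧ ∀ (a : X) (g ρ : X → ℝ) (z : ℝ),
      (∀ A, 0 ≤ g A) → (∀ A, 0 ≤ ρ A) →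
      AEStronglyMeasurable (fun p : M₀ × Λ => g (a + σ p.1 - D p.2)) (μ₀.prod ν) →
      AEStronglyMeasurable (fun m => ρ (a + σ m)) μ₀ →
      (∀ m l, ρ (a + σ m - D l) = ρ (a + σ m)) → (∀ m, ∫ l, g (a + σ m - D l) ∂ν ≠ 0) →
      z * ∫ m, ρ (a + σ m) ∂μ₀ =
        (z * c) * ∫ n, g (a + ι n) * (∫ l, g (a + ι n - D l) ∂ν)⁻¹ * ρ (a + ι n) ∂μ := by
  refine ⟨Measure.addHaarScalarFactor ((μ₀.prod ν).map e) μ, by exact_mod_cast jacobian_pos μ₀ ν μ e, ?_⟩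
  intro a g ρ z hg0 hρ0 hgm hρm hρ hZ
  have he' : ∀ m l, a + ι (e (m, l)) = (fun m => a + σ m) m - D l := by
    intro m l
    simp only [he, add_sub_assoc]
  exact eq123 μ₀ ν μ e a ι (fun m => a + σ m) D he' g ρ hg0 hρ0 hgm hρm hρ hZ z

end Assembly

end Literature.MathematicalPhysics.QuantumFieldTheory.Balaban1983to89.B5ChangeOfGauge123

end
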